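import Mathlib
import Summits.PneNP.PneNP.Theorems.ConvexRankGatesConvexGateBlindL1LinearCore

/-!
# PneNP / ConvexRankGates — `ConvexGateBlind`: the ℓ₁-constant of clique-non-negative weightings is `O(k)`, UNCONDITIONALLY

Helpers (`--supports stmt-PneNP-10680`), COLUMN-SPACE line (prover seat 2, session 19). MAIN THEOREM
(`sum_sum_abs_le_linear`, matrix form; `abs_sum_le_linear`, edge form; registered stub `l1_constant_le_linear`): for `4 ≤ k`,
`2k + 2 ≤ m` and every symmetric zero-diagonal `k`-clique-non-negative `V`,

  `ΣΣ |V| ≤ (32k − 3) · ΣΣ V`,   hence `∑_e |w(e)| ≤ (400k − 1)·∑_e w(e)` for `m ≥ 400k`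

— the statement `abs_sum_le_linear_of_montgomery` of `…L1Montgomery` WITHOUT the Montgomery hypothesis. Session 16 had this
only conditionally on Montgomery's fractional `K_k`-decomposition theorem (named fact); the tree's unconditional constant was
`2k² − 4k + 1` (`…CliqueNonnegL1`). PROOF (pool measure, `…PoolMeasure`/`…PoolPair`/`…L1LinearCore`): with the pattern
`F = [V < 0]`, the pool pairing gives `0 ≤ α·S + β·ΣΣV·rc F` (`S = ΣΣV`), i.e. a bound on the negative mass `N` up to the
degree correction `W = Σ_z deg F z · row_V z`, which the degree pairing controls (`−2(m−k)W ≤ (k−2)·S·tot F`); the constants: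
`α/β = 4(k−1)/c(m,n) ≤ 12(k−1)`, `tot F ≤ m(m−1)`, whence `N ≤ (16k − 18)S` and `ΣΣ|V| = S + 2N`. Odd `k` reduces to `k+1`
(`valid_succ`). By duality this is an EXACT two-weight fractional `K_k`-decomposition of `K_m` (`1_E + ε·1_A` is a
non-negative combination of `k`-cliques for every edge set `A`, `ε = Θ(1/k)`); the cut weighting (`…L1LowerBound`,
`ΣΣ|V| > (k−1)ΣΣV`) shows the order `k` is sharp. CONSEQUENCE: `…ColumnSpaceHalf` / `…RankPlusOneHalf` become unconditional
(`…ColumnSpaceHalfUnconditional`). [new]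
-/

set_option linter.dupNamespace false

namespace Summit.PneNP.PneNP.Theorems

open Finset

noncomputable section

variable {m : ℕ}

open Literature.Computability.Complexity
open Summit.PneNP.PneNP.Cruxes.ConvexGateBlind.StrictRankConicCover (Edge)

/-! ## Validity is monotone in `k` -/

/-- **Erasing identity:** `∑_{z∈Q} S_V(Q ∖ z) = (#Q − 2)·S_V(Q)` for zero-diagonal `V`. [new] -/
theorem sum_erase_sum_sum (V : Fin m → Fin m → ℝ) (hV0 : ∀ a, V a a = 0) (Q : Finset (Fin m)) :
    ∑ z ∈ Q, ∑ a ∈ Q.erase z, ∑ b ∈ Q.erase z, V a b = ((Q.card : ℝ) - 2) * ∑ a ∈ Q, ∑ b ∈ Q, V a b := by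
  classical
  -- write the erased sums with indicators over `Q`
  have hin : ∀ z ∈ Q, ∑ a ∈ Q.erase z, ∑ b ∈ Q.erase z, V a b =
      ∑ a ∈ Q, ∑ b ∈ Q, (if a ≠ z ∧ b ≠ z then V a b else 0) := by
    intro z _
    rw [← Finset.sum_filter_add_sum_filter_not Q (fun a => a ≠ z)]
    have hf : Q.filter (fun a => a ≠ z) = Q.erase z := by ext a; simp [Finset.mem_erase, and_comm]
    have hf' : Q.filter (fun a => ¬ a ≠ z) = Q.filter (fun a => a = z) := Finset.filter_congr (fun a _ => by tauto)
    rw [hf, hf']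
    have h2 : ∑ a ∈ Q.filter (fun a => a = z), ∑ b ∈ Q, (if a ≠ z ∧ b ≠ z then V a b else 0) = 0 := by
      refine Finset.sum_eq_zero fun a ha => Finset.sum_eq_zero fun b _ => ?_
      rw [Finset.mem_filter] at ha
      rw [if_neg (fun h => h.1 ha.2)]
    rw [h2, add_zero]
    refine Finset.sum_congr rfl fun a ha => ?_
    have haz : a ≠ z := (Finset.mem_erase.1 ha).1
    rw [← Finset.sum_filter_add_sum_filter_not Q (fun b => b ≠ z)]
    have hg : Q.filter (fun b => b ≠ z) = Q.erase z := by ext b; simp [Finset.mem_erase, and_comm]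
    have h3 : ∑ b ∈ Q.filter (fun b => ¬ b ≠ z), (if a ≠ z ∧ b ≠ z then V a b else 0) = 0 := by
      refine Finset.sum_eq_zero fun b hb => ?_
      rw [Finset.mem_filter] at hb
      rw [if_neg (fun h => hb.2 h.2)]
    rw [hg, h3, add_zero]
    refine Finset.sum_congr rfl fun b hb => ?_
    rw [if_pos ⟨haz, (Finset.mem_erase.1 hb).1⟩]
  rw [Finset.sum_congr rfl hin, Finset.sum_comm]
  rw [Finset.mul_sum]
  refine Finset.sum_congr rfl fun a ha => ?_
  rw [Finset.sum_comm, Finset.mul_sum]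
  refine Finset.sum_congr rfl fun b hb => ?_
  -- `∑_{z∈Q} [a ≠ z ∧ b ≠ z]·V a b = (#Q − 2)·V a b` for `a ≠ b`; both vanish for `a = b`
  by_cases hab : a = b
  · subst hab; rw [hV0]; simp
  · rw [← Finset.sum_filter, Finset.sum_const, nsmul_eq_mul]
    have hf : Q.filter (fun z => a ≠ z ∧ b ≠ z) = (Q.erase a).erase b := by
      ext z; simp [Finset.mem_erase]; tauto
    rw [hf, Finset.card_erase_of_mem (Finset.mem_erase.2 ⟨Ne.symm hab, hb⟩), Finset.card_erase_of_mem ha]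
    have h2 : 2 ≤ Q.card := by
      have : ({a, b} : Finset (Fin m)) ⊆ Q := by simp [Finset.insert_subset_iff, ha, hb]
      have hc := Finset.card_le_card this
      rwa [Finset.card_insert_of_notMem (by simpa using hab), Finset.card_singleton] at hc
    rw [Nat.cast_sub (by omega), Nat.cast_sub (by omega)]
    push_cast
    ring

/-- **Clique-non-negativity is monotone in `k`:** valid on `k`-sets (`2 ≤ k`) implies valid on `(k+1)`-sets. [new] -/
theorem valid_succ (V : Fin m → Fin m → ℝ) (hV0 : ∀ a, V a a = 0) {k : ℕ} (hk : 3 ≤ k)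
    (hvalid : ∀ Q ∈ (Finset.univ : Finset (Fin m)).powersetCard k, 0 ≤ ∑ x ∈ Q, ∑ y ∈ Q, V x y) :
    ∀ Q ∈ (Finset.univ : Finset (Fin m)).powersetCard (k + 1), 0 ≤ ∑ x ∈ Q, ∑ y ∈ Q, V x y := by
  intro Q hQ
  rw [Finset.mem_powersetCard] at hQ
  have h := sum_erase_sum_sum V hV0 Q
  rw [hQ.2] at h
  have hpos : 0 ≤ ∑ z ∈ Q, ∑ a ∈ Q.erase z, ∑ b ∈ Q.erase z, V a b := by
    refine Finset.sum_nonneg fun z hz => hvalid _ ?_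
    rw [Finset.mem_powersetCard]
    exact ⟨Finset.subset_univ _, by rw [Finset.card_erase_of_mem hz, hQ.2]; omega⟩
  rw [h] at hpos
  have hk' : (0 : ℝ) < ((k + 1 : ℕ) : ℝ) - 2 := by
    have : (3 : ℝ) ≤ k := by exact_mod_cast hk
    push_cast; linarith
  exact (mul_nonneg_iff_of_pos_left hk').1 hpos

/-! ## The even case -/

/-- `|v| = v − 2·v·[v < 0]`. [folklore] -/
theorem abs_eq_sub_two_mul_neg (v : ℝ) : |v| = v - 2 * (v * (if v < 0 then (1 : ℝ) else 0)) := by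
  by_cases h : v < 0
  · rw [if_pos h, abs_of_neg h]; ring
  · rw [if_neg h, abs_of_nonneg (not_lt.1 h)]; ring

/-- Arithmetic of the biased pool pairing: `0 ≤ αS + βRr` with `α/β = 4(2r−1)/c`, `c ≥ 1/3`, `S ≥ 0` gives
`Rr ≥ −12(2r−1)S`. [new] -/
theorem l1_from_pairing {r m S Rr c : ℝ} (hr : 1 ≤ r) (hm : 2 ≤ m) (hc : 1 / 3 ≤ c) (hS : 0 ≤ S)
    (h : 0 ≤ 2 * r * (2 * r - 1) / (m * (m - 1)) * S + 2 * r * (1 / 4) * c / (m * (m - 1)) * Rr) :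
    -(12 * (2 * r - 1)) * S ≤ Rr := by
  have hD : 0 < m * (m - 1) := by nlinarith
  have h1 : 0 ≤ (2 * r * (2 * r - 1) * S + 2 * r * (1 / 4) * c * Rr) / (m * (m - 1)) := by
    have : 2 * r * (2 * r - 1) / (m * (m - 1)) * S + 2 * r * (1 / 4) * c / (m * (m - 1)) * Rr =
        (2 * r * (2 * r - 1) * S + 2 * r * (1 / 4) * c * Rr) / (m * (m - 1)) := by
      field_simp
    rw [this] at h; exact h
  have h2 : 0 ≤ 2 * r * (2 * r - 1) * S + 2 * r * (1 / 4) * c * Rr := (div_nonneg_iff.1 h1).elim (fun h => h.1)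
    (fun h => by nlinarith [h.2])
  -- divide by `r > 0`
  have h3 : 0 ≤ r * (2 * (2 * r - 1) * S + (c / 2) * Rr) := by nlinarith [h2]
  have h4 : 0 ≤ 2 * (2 * r - 1) * S + (c / 2) * Rr := (mul_nonneg_iff_of_pos_left (by linarith)).1 h3
  -- case on the sign of `Rr`
  by_cases hR : 0 ≤ Rr
  · have : 0 ≤ (2 * r - 1) * S := mul_nonneg (by linarith) hS
    nlinarith
  · have hR' : Rr < 0 := not_le.1 hR
    have : (c / 2) * Rr ≤ (1 / 6) * Rr := by nlinarith
    nlinarith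

/-- Arithmetic endgame of the linear ℓ₁-bound. [new] -/
theorem l1_endgame {r m S N W T Rr : ℝ} (hr : 2 ≤ r) (hm : 4 * r ≤ m) (hS0 : 0 ≤ S)
    (hR2 : -(12 * (2 * r - 1)) * S ≤ Rr) (hRr : Rr = -N - 2 * W / (m - 2) + T * S / ((m - 1) * (m - 2)))
    (hD' : -(2 * (m - 2 * r)) * W ≤ (2 * r - 2) * S * T) (hTle : T ≤ m * (m - 1)) :
    N ≤ (32 * r - 18) * S := by
  have hm8 : 8 ≤ m := by linarith
  have hd1 : 0 < m - 2 := by linarith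
  have hd2 : 0 < m - 1 := by linarith
  have hd3 : 0 < m - 2 * r := by linarith
  have h2r : 0 ≤ 2 * r - 2 := by linarith
  -- first error term: `−2W/(m−2) ≤ 4(2r−2)S`
  have h1 : (2 * r - 2) * S * T ≤ (2 * r - 2) * S * (m * (m - 1)) :=
    mul_le_mul_of_nonneg_left hTle (mul_nonneg h2r hS0)
  have hm0 : 0 ≤ m := by linarith
  have h2 : m * (m - 1) ≤ 4 * (m - 2) * (m - 2 * r) := by
    nlinarith [mul_nonneg hm0 (sub_nonneg.2 hm), mul_nonneg hm0 (by linarith : (0 : ℝ) ≤ 4 * r - 7)]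
  have h3 : (2 * r - 2) * S * (m * (m - 1)) ≤ (2 * r - 2) * S * (4 * (m - 2) * (m - 2 * r)) :=
    mul_le_mul_of_nonneg_left h2 (mul_nonneg h2r hS0)
  have h4 : (-2 * W) * (m - 2 * r) ≤ (4 * (2 * r - 2) * S * (m - 2)) * (m - 2 * r) := by nlinarith [hD', h1, h3]
  have h5 : -2 * W ≤ 4 * (2 * r - 2) * S * (m - 2) := le_of_mul_le_mul_right h4 hd3
  have hE1 : -(2 * W / (m - 2)) ≤ 4 * (2 * r - 2) * S := by
    rw [neg_le, le_div_iff₀ hd1]; nlinarith [h5]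
  -- second error term: `TS/((m−1)(m−2)) ≤ 2S`
  have hE2 : T * S / ((m - 1) * (m - 2)) ≤ 2 * S := by
    rw [div_le_iff₀ (mul_pos hd2 hd1)]
    have h6 : T * S ≤ m * (m - 1) * S := mul_le_mul_of_nonneg_right hTle hS0
    have h7 : m * (m - 1) * S ≤ 2 * (m - 1) * (m - 2) * S :=
      mul_le_mul_of_nonneg_right (by nlinarith) hS0
    nlinarith [h6, h7]
  rw [hRr] at hR2
  nlinarith [hE1, hE2, hR2]

/-- **The linear ℓ₁-bound, even `k = 2r`** (`2 ≤ r`, `2k ≤ m`): `ΣΣ|V| ≤ (32k − 35)·ΣΣV`. [new] -/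
theorem sum_sum_abs_le_linear_even {r : ℕ} (hr : 2 ≤ r) (hm : 4 * r ≤ m) (V : Fin m → Fin m → ℝ)
    (hV : ∀ a b, V a b = V b a) (hV0 : ∀ a, V a a = 0)
    (hvalid : ∀ Q ∈ (Finset.univ : Finset (Fin m)).powersetCard (2 * r), 0 ≤ ∑ x ∈ Q, ∑ y ∈ Q, V x y) :
    ∑ a, ∑ b, |V a b| ≤ (32 * (2 * (r : ℝ)) - 35) * ∑ a, ∑ b, V a b := by
  classical
  -- the pattern
  set F : Fin m → Fin m → ℝ := fun a b => if V a b < 0 then 1 else 0 with hF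
  have hFsym : ∀ a b, F a b = F b a := by intro a b; simp only [hF, hV a b]
  have hF0 : ∀ a b, 0 ≤ F a b := by intro a b; simp only [hF]; split_ifs <;> norm_num
  have hF1 : ∀ a b, F a b ≤ 1 := by intro a b; simp only [hF]; split_ifs <;> norm_num
  -- pool size `nP = ⌊m/r⌋ ≥ 4`
  have hr0 : 0 < r := by omega
  set nP : ℕ := m / r with hnP
  have hn4 : 4 ≤ nP := by rw [hnP, Nat.le_div_iff_mul_le hr0]; omega
  have hnr : nP * r ≤ m := by rw [hnP]; exact Nat.div_mul_le_self m r
  have hnm : nP ≤ m := le_trans (Nat.le_mul_of_pos_right _ hr0) hnr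
  have hν : ∀ η : ℝ, 0 ≤ η → η ≤ 1 / 3 →
      ∀ (P : Finset (Fin m)) (a b : Fin m), P.card = nP → a ∈ P → b ∈ P → 0 ≤ poolNu η nP F P a b :=
    fun η h0 h1 P a b hP ha hb => poolNu_nonneg η nP F hF0 hF1 h0 h1 hP hn4 ha hb
  -- the two pool pairings (`η = 1/4` and `η = 0`) and the degree pairing
  have hP1 := pool_pairing (1 / 4) nP F hFsym (hν (1 / 4) (by norm_num) (by norm_num)) hn4 r hnr V hV0 hvalid
  have hP0 := pool_pairing 0 nP F hFsym (hν 0 le_rfl (by norm_num)) hn4 r hnr V hV0 hvalid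
  have hD := degree_pairing V hV hV0 (k := 2 * r) (by omega) (by omega) hvalid
    (fun z => poolDeg (Finset.univ : Finset (Fin m)) F z) (fun z => poolDeg_nonneg _ F hF0 z)
  have hexp := sum_sum_mul_poolRc V F hV
  unfold poolAlpha poolBeta at hP1 hP0
  -- real-number facts
  have hrR : (2 : ℝ) ≤ r := by exact_mod_cast hr
  have hmR : 4 * (r : ℝ) ≤ m := by exact_mod_cast hm
  have hnR : (4 : ℝ) ≤ nP := by exact_mod_cast hn4
  have hnmR : (nP : ℝ) ≤ m := by exact_mod_cast hnm
  -- `c ≥ 1/3`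
  have hc3 : 1 / 3 ≤ poolCoef m nP := by
    have h1 := poolCoef_ge hnR hnmR
    have h2 : (1 : ℝ) / 3 ≤ ((nP : ℝ) - 3) / ((nP : ℝ) - 1) := by
      rw [div_le_div_iff₀ (by norm_num) (by linarith)]; linarith
    exact le_trans h2 h1
  -- `S ≥ 0` from the unbiased pool pairing
  have hS0 : 0 ≤ ∑ a, ∑ b, V a b := by
    have hαpos : 0 < 2 * (r : ℝ) * (2 * (r : ℝ) - 1) / ((m : ℝ) * ((m : ℝ) - 1)) := div_pos (by nlinarith) (by nlinarith)
    simp only [mul_zero, zero_mul, zero_div, add_zero] at hP0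
    exact (mul_nonneg_iff_of_pos_left hαpos).1 hP0
  -- the biased pool pairing: `Rr ≥ −12(2r−1)·S`
  have hR2 := l1_from_pairing (by linarith) (by linarith) hc3 hS0 hP1
  -- the degree pairing: `−2(m−2r)W ≤ (2r−2)·S·T`
  have hC3pos : (0 : ℝ) < ((m - 3).choose (2 * r - 3) : ℝ) := by exact_mod_cast Nat.choose_pos (by omega)
  have hCrel : ((m - 3).choose (2 * r - 2) : ℝ) * (2 * (r : ℝ) - 2) =
      ((m - 3).choose (2 * r - 3) : ℝ) * ((m : ℝ) - 2 * r) := by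
    have h := Nat.choose_succ_right_eq (m - 3) (2 * r - 3)
    have e1 : 2 * r - 3 + 1 = 2 * r - 2 := by omega
    rw [e1] at h
    have h' : (((m - 3).choose (2 * r - 2) : ℕ) : ℝ) * ((2 * r - 2 : ℕ) : ℝ) =
        (((m - 3).choose (2 * r - 3) : ℕ) : ℝ) * ((m - 3 - (2 * r - 3) : ℕ) : ℝ) := by exact_mod_cast h
    have c1 : ((2 * r - 2 : ℕ) : ℝ) = 2 * (r : ℝ) - 2 := by rw [Nat.cast_sub (by omega)]; push_cast; ring
    have c2 : ((m - 3 - (2 * r - 3) : ℕ) : ℝ) = (m : ℝ) - 2 * r := by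
      rw [Nat.cast_sub (by omega), Nat.cast_sub (by omega), Nat.cast_sub (by omega)]; push_cast; ring
    rw [c1, c2] at h'
    exact h'
  set T : ℝ := poolTot (Finset.univ : Finset (Fin m)) F with hT
  set W : ℝ := ∑ z, poolDeg (Finset.univ : Finset (Fin m)) F z * ∑ b, V z b with hW
  have hTsum : ∑ z, poolDeg (Finset.univ : Finset (Fin m)) F z = T := rfl
  rw [hTsum] at hD
  have hD' : -(2 * ((m : ℝ) - 2 * r)) * W ≤ (2 * (r : ℝ) - 2) * (∑ a, ∑ b, V a b) * T := by
    have h2r : (0 : ℝ) ≤ 2 * (r : ℝ) - 2 := by linarith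
    have h1 := mul_nonneg h2r hD
    have h2 : (2 * (r : ℝ) - 2) * (((m - 3).choose (2 * r - 3) : ℝ) * (∑ a, ∑ b, V a b) * T +
        2 * ((m - 3).choose (2 * r - 2) : ℝ) * W) =
        ((m - 3).choose (2 * r - 3) : ℝ) * ((2 * (r : ℝ) - 2) * (∑ a, ∑ b, V a b) * T + 2 * ((m : ℝ) - 2 * r) * W) := by
      linear_combination (2 * W) * hCrel
    rw [h2] at h1
    have h3 := (mul_nonneg_iff_of_pos_left hC3pos).1 h1
    linarith
  -- `T ≤ m(m−1)`
  have hTle : T ≤ (m : ℝ) * ((m : ℝ) - 1) := by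
    rw [hT]
    unfold poolTot
    have hcard : ((Finset.univ : Finset (Fin m)).card : ℝ) = m := by rw [Finset.card_univ, Fintype.card_fin]
    calc ∑ x, poolDeg Finset.univ F x ≤ ∑ _x : Fin m, ((m : ℝ) - 1) :=
          Finset.sum_le_sum fun x _ => by
            have := poolDeg_le (Finset.univ : Finset (Fin m)) F hF1 (Finset.mem_univ x)
            rwa [hcard] at this
      _ = (m : ℝ) * ((m : ℝ) - 1) := by
          rw [Finset.sum_const, nsmul_eq_mul, Finset.card_univ, Fintype.card_fin]
  -- endgame
  have hexp' : ∑ a, ∑ b, V a b * poolRc (Finset.univ : Finset (Fin m)) F a b =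
      -(-(∑ a, ∑ b, V a b * F a b)) - 2 * W / ((m : ℝ) - 2) +
        T * (∑ a, ∑ b, V a b) / (((m : ℝ) - 1) * ((m : ℝ) - 2)) := by
    rw [neg_neg]; exact hexp
  have hNle := l1_endgame hrR hmR hS0 hR2 hexp' hD' hTle
  have habs : ∑ a, ∑ b, |V a b| = (∑ a, ∑ b, V a b) + 2 * (-(∑ a, ∑ b, V a b * F a b)) := by
    rw [Finset.sum_congr rfl (fun a _ => Finset.sum_congr rfl (fun b _ => abs_eq_sub_two_mul_neg (V a b)))]
    simp only [Finset.sum_sub_distrib, ← Finset.mul_sum]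
    ring
  rw [habs]
  linarith

/-! ## The general statement -/

/-- **The linear ℓ₁-bound (matrix form), unconditionally.** For `4 ≤ k`, `2k + 2 ≤ m` and every symmetric zero-diagonal
`k`-clique-non-negative `V`: `ΣΣ|V| ≤ (32k − 3)·ΣΣV`. (Session 16 had `400k − 1` conditionally on Montgomery's theorem; the
tree's unconditional constant was `2k² − 4k + 1`.) [new] -/
theorem sum_sum_abs_le_linear {k : ℕ} (hk : 4 ≤ k) (hm : 2 * k + 2 ≤ m) (V : Fin m → Fin m → ℝ)
    (hV : ∀ a b, V a b = V b a) (hV0 : ∀ a, V a a = 0)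
    (hvalid : ∀ Q ∈ (Finset.univ : Finset (Fin m)).powersetCard k, 0 ≤ ∑ x ∈ Q, ∑ y ∈ Q, V x y) :
    ∑ a, ∑ b, |V a b| ≤ (32 * (k : ℝ) - 3) * ∑ a, ∑ b, V a b := by
  rcases Nat.even_or_odd k with ⟨r, hr⟩ | ⟨r, hr⟩
  · -- `k = r + r`
    have hr2 : 2 ≤ r := by omega
    have hk2 : k = 2 * r := by omega
    subst hk2
    have h := sum_sum_abs_le_linear_even hr2 (by omega) V hV hV0 hvalid
    have hS0 : 0 ≤ ∑ a, ∑ b, V a b := by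
      -- from the bound itself: `0 ≤ ΣΣ|V| ≤ (32k−35)ΣΣV` with `32k − 35 > 0`
      have habs : 0 ≤ ∑ a, ∑ b, |V a b| := Finset.sum_nonneg fun a _ => Finset.sum_nonneg fun b _ => abs_nonneg _
      have hpos : (0 : ℝ) < 32 * (2 * (r : ℝ)) - 35 := by
        have : (2 : ℝ) ≤ r := by exact_mod_cast hr2
        linarith
      nlinarith
    push_cast at h ⊢
    nlinarith
  · -- `k = 2r + 1`: pass to `k + 1 = 2(r+1)`
    have hr1 : 2 ≤ r + 1 := by omega
    have hvalid' := valid_succ V hV0 (by omega) hvalid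
    have hk1 : k + 1 = 2 * (r + 1) := by omega
    rw [hk1] at hvalid'
    have h := sum_sum_abs_le_linear_even hr1 (by omega) V hV hV0 hvalid'
    have hS0 : 0 ≤ ∑ a, ∑ b, V a b := by
      have habs : 0 ≤ ∑ a, ∑ b, |V a b| := Finset.sum_nonneg fun a _ => Finset.sum_nonneg fun b _ => abs_nonneg _
      have hpos : (0 : ℝ) < 32 * (2 * ((r + 1 : ℕ) : ℝ)) - 35 := by
        have : (2 : ℝ) ≤ ((r + 1 : ℕ) : ℝ) := by exact_mod_cast hr1
        linarith
      nlinarith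
    have hkR : (k : ℝ) = 2 * r + 1 := by rw [hr]; push_cast; ring
    push_cast at h
    rw [hkR]
    nlinarith

/-- **The ℓ₁-constant is `O(k)`, unconditionally (edge form).** For `4 ≤ k`, `400k ≤ m` and every `k`-clique-non-negative edge
weighting `w` of `K_m`: `∑_e |w(e)| ≤ (400k − 1)·∑_e w(e)` — `abs_sum_le_linear_of_montgomery` without the hypothesis. [new] -/
theorem abs_sum_le_linear {k : ℕ} (hk : 4 ≤ k) (hm : 400 * k ≤ m) (w : Edge m → ℝ)
    (hw : ∀ Q ∈ (Finset.univ : Finset (Fin m)).powersetCard k, 0 ≤ softWindow w Q) :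
    ∑ e, |w e| ≤ (400 * (k : ℝ) - 1) * ∑ e, w e := by
  classical
  obtain ⟨V, hVdef⟩ : ∃ V : Fin m → Fin m → ℝ,
      V = fun x y => if h : x = y then 0 else w ⟨s(x, y), CliqueExtLowerBound.Negative.mk_mem_edgeSet_top h⟩ := ⟨_, rfl⟩
  have hV0 : ∀ x, V x x = 0 := fun x => by rw [hVdef]; simp
  have hVoff : ∀ (x y : Fin m) (h : x ≠ y), V x y = w ⟨s(x, y), CliqueExtLowerBound.Negative.mk_mem_edgeSet_top h⟩ :=
    fun x y h => by rw [hVdef]; simp [h]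
  have hVsym : ∀ x y, V x y = V y x := by
    intro x y
    by_cases h : x = y
    · rw [h]
    · rw [hVoff x y h, hVoff y x (Ne.symm h)]
      congr 1
      exact Subtype.ext Sym2.eq_swap
  have hvalidM : ∀ Q ∈ (Finset.univ : Finset (Fin m)).powersetCard k, 0 ≤ ∑ x ∈ Q, ∑ y ∈ Q, V x y := by
    intro Q hQ
    have h := hw Q hQ
    rw [softWindow_eq_half_sum_sum w V hV0 hVoff Q] at h
    linarith
  have hmass : ∑ e, w e = (∑ x, ∑ y, V x y) / 2 := sum_edge_eq_half_sum_sum w V hV0 hVoff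
  have habsmass : ∑ e, |w e| = (∑ x, ∑ y, |V x y|) / 2 :=
    sum_edge_eq_half_sum_sum (fun e => |w e|) (fun x y => |V x y|) (fun x => by rw [hV0, abs_zero])
      (fun x y h => by rw [hVoff x y h])
  rw [hmass, habsmass]
  have hmain := sum_sum_abs_le_linear hk (by omega) V hVsym hV0 hvalidM
  have hS0 : 0 ≤ ∑ x, ∑ y, V x y := by
    have habs : 0 ≤ ∑ a, ∑ b, |V a b| := Finset.sum_nonneg fun a _ => Finset.sum_nonneg fun b _ => abs_nonneg _
    have hkR : (4 : ℝ) ≤ k := by exact_mod_cast hk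
    nlinarith
  have hkR : (4 : ℝ) ≤ k := by exact_mod_cast hk
  rw [mul_div_assoc']
  refine div_le_div_of_nonneg_right ?_ (by norm_num)
  nlinarith

/-- **The ℓ₁-constant is `O(k)`, unconditionally** (registered form of `abs_sum_le_linear`; the statement of
`l1_constant_le_of_montgomery` with the Montgomery hypothesis removed). [new] -/
theorem l1_constant_le_linear : ∀ {m k : ℕ}, 4 ≤ k → 400 * k ≤ m → ∀ (w : Edge m → ℝ), (∀ Q ∈ (Finset.univ : Finset (Fin m)).powersetCard k, 0 ≤ softWindow w Q) → ∑ e, |w e| ≤ (400 * (k : ℝ) - 1) * ∑ e, w e :=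
  fun hk hm w hw => abs_sum_le_linear hk hm w hw

end

end Summit.PneNP.PneNP.Theorems
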